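import Mathlib
import Summits.Ventures.HodgeRepro2.Hypothesis
import Summits.Ventures.HodgeRepro2.BallActionU21
import Summits.Ventures.HodgeRepro2.DefiniteUnitaryBounded

/-!
# Bounded stabilisers in `U(2,1)`: the invariant positive definite form of a negative line

The geometric consequence of discreteness used by Shimura (J. Math. Soc. Japan 31 (1979), §4–§8) and
Dimitrov–Ramakrishnan (Doc. Math. 20 (2015), §1–§2) — `Γ\𝔹²` is a compact complex surface for neat
`Γ` — rests on the action of `Γ` on the ball being proper with FINITE stabilisers.  The `U(2,1)`-half
of that statement is kernel-checked here; the arithmetic half is `BallFreeAction.lean`.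

* `hermPair` — the sesquilinear form `⟨u, v⟩ = uᴴ J v` of signature `(2,1)` (`J = J21`), with its
  elementary rules and `hermJ21_nonneg_of_hermPair_eq_zero` (the form is positive definite on the
  orthogonal complement of a negative vector — Cauchy–Schwarz in coordinates);
* `hermJ21_add_pos` — for a negative vector `w` and `x ≠ 0`,
  `hermJ21 x + (2/|⟨w,w⟩|) ‖⟨w,x⟩‖² > 0` (decompose `x = a w + y` with `⟨w, y⟩ = 0`);
* `stabForm w = J + (2/|⟨w,w⟩|) (Jw)(Jw)ᴴ` — a POSITIVE DEFINITE Hermitian form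
  (`stabForm_posDef`) preserved by every `α ∈ U(2,1)` fixing the line `ℂ w`
  (`IsInU21.conjTranspose_mul_stabForm_mul`; `|λ| = 1` and `αᴴ (Jw) = λ⁻¹ Jw`);
* `exists_entry_bound_of_mulVec_eq_smul` — hence, by `exists_entry_bound_of_posDef`
  (`DefiniteUnitaryBounded.lean`), **the stabiliser in `U(2,1)` of a negative line has bounded
  entries**;
* `IsInU21.exists_mulVec_homog_eq_smul_of_ballAction_eq` — `α` fixes `z ∈ 𝔹²` only if it fixes the
  negative line `ℂ · homog z`.
-/

open Matrix
open scoped ComplexOrder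

namespace Summit.Ventures.HodgeRepro2.ShimuraData

/-! ### The hermitian pairing of signature `(2,1)` -/

/-- The sesquilinear pairing `⟨u, v⟩ = uᴴ J₂₁ v` (antilinear in `u`, linear in `v`). -/
def hermPair (u v : Fin 3 → ℂ) : ℂ := star u ⬝ᵥ (J21 *ᵥ v)

/-- `⟨v, v⟩ = hermJ21 v`. -/
theorem hermPair_self (v : Fin 3 → ℂ) : hermPair v v = (hermJ21 v : ℂ) :=
  star_dotProduct_J21_mulVec v

/-- `J₂₁` is Hermitian. -/
theorem J21_conjTranspose : J21ᴴ = J21 := by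
  unfold J21
  rw [diagonal_conjTranspose]
  congr 1
  ext i
  fin_cases i <;> simp

/-- Conjugate symmetry of the pairing. -/
theorem hermPair_conj (u v : Fin 3 → ℂ) : hermPair v u = star (hermPair u v) := by
  unfold hermPair
  rw [star_dotProduct, star_mulVec, J21_conjTranspose, ← dotProduct_mulVec]

/-- Antilinearity in the first slot. -/
theorem hermPair_smul_left (a : ℂ) (u v : Fin 3 → ℂ) :
    hermPair (a • u) v = star a * hermPair u v := by
  unfold hermPair
  rw [star_smul, smul_dotProduct, smul_eq_mul]

/-- Linearity in the second slot. -/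
theorem hermPair_smul_right (a : ℂ) (u v : Fin 3 → ℂ) :
    hermPair u (a • v) = a * hermPair u v := by
  unfold hermPair
  rw [mulVec_smul, dotProduct_smul, smul_eq_mul]

/-- Additivity in the first slot. -/
theorem hermPair_add_left (u u' v : Fin 3 → ℂ) :
    hermPair (u + u') v = hermPair u v + hermPair u' v := by
  unfold hermPair
  rw [star_add, add_dotProduct]

/-- Additivity in the second slot. -/
theorem hermPair_add_right (u v v' : Fin 3 → ℂ) :
    hermPair u (v + v') = hermPair u v + hermPair u v' := by
  unfold hermPair
  rw [mulVec_add, dotProduct_add]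

/-- Subtraction in the second slot. -/
theorem hermPair_sub_right (u v v' : Fin 3 → ℂ) :
    hermPair u (v - v') = hermPair u v - hermPair u v' := by
  unfold hermPair
  rw [mulVec_sub, dotProduct_sub]

/-- The pairing in coordinates. -/
theorem hermPair_eq (u v : Fin 3 → ℂ) :
    hermPair u v = star (u 0) * v 0 + star (u 1) * v 1 - star (u 2) * v 2 := by
  unfold hermPair J21
  simp only [dotProduct, Fin.sum_univ_three, mulVec_diagonal, Pi.star_apply]
  simp [Matrix.cons_val_zero, Matrix.cons_val_one]
  ring

/-- `hermJ21 (c • v) = ‖c‖² hermJ21 v`. -/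
theorem hermJ21_smul (c : ℂ) (v : Fin 3 → ℂ) : hermJ21 (c • v) = ‖c‖ ^ 2 * hermJ21 v := by
  unfold hermJ21
  simp only [Pi.smul_apply, norm_smul, mul_pow]
  ring

/-- The form `hermJ21` is positive on the orthogonal complement of a negative vector `w`, and
definite there: if `⟨w, y⟩ = 0` then `hermJ21 y ≥ 0`, with equality only for `y = 0`. -/
theorem hermJ21_nonneg_of_hermPair_eq_zero {w y : Fin 3 → ℂ} (hw : hermJ21 w < 0)
    (h : hermPair w y = 0) : 0 ≤ hermJ21 y ∧ (hermJ21 y = 0 → y = 0) := by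
  rw [hermPair_eq] at h
  have h' : star (w 2) * y 2 = star (w 0) * y 0 + star (w 1) * y 1 := by
    rw [sub_eq_zero] at h; exact h.symm
  -- norms
  have h1 : ‖w 2‖ * ‖y 2‖ ≤ ‖w 0‖ * ‖y 0‖ + ‖w 1‖ * ‖y 1‖ := by
    have := congrArg norm h'
    rw [norm_mul, norm_star] at this
    rw [this]
    refine (norm_add_le _ _).trans ?_
    rw [norm_mul, norm_mul, norm_star, norm_star]
  unfold hermJ21 at hw ⊢
  set A := ‖w 0‖ with hA
  set B := ‖w 1‖ with hB
  set W := ‖w 2‖ with hW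
  set a := ‖y 0‖ with ha
  set b := ‖y 1‖ with hb
  set c := ‖y 2‖ with hc
  have hA0 : 0 ≤ A := norm_nonneg _
  have hB0 : 0 ≤ B := norm_nonneg _
  have hW0 : 0 ≤ W := norm_nonneg _
  have ha0 : 0 ≤ a := norm_nonneg _
  have hb0 : 0 ≤ b := norm_nonneg _
  have hc0 : 0 ≤ c := norm_nonneg _
  have h2 : (W * c) ^ 2 ≤ (A * a + B * b) ^ 2 := pow_le_pow_left₀ (by positivity) h1 2
  have h3 : (A * a + B * b) ^ 2 ≤ (A ^ 2 + B ^ 2) * (a ^ 2 + b ^ 2) := by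
    nlinarith [sq_nonneg (A * b - B * a)]
  have h4 : (A ^ 2 + B ^ 2) * (a ^ 2 + b ^ 2) ≤ W ^ 2 * (a ^ 2 + b ^ 2) :=
    mul_le_mul_of_nonneg_right (by linarith) (by positivity)
  have hW2 : 0 < W ^ 2 := by nlinarith [sq_nonneg A, sq_nonneg B]
  have h5 : W ^ 2 * c ^ 2 ≤ W ^ 2 * (a ^ 2 + b ^ 2) := by
    calc W ^ 2 * c ^ 2 = (W * c) ^ 2 := by ring
      _ ≤ (A * a + B * b) ^ 2 := h2
      _ ≤ (A ^ 2 + B ^ 2) * (a ^ 2 + b ^ 2) := h3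
      _ ≤ W ^ 2 * (a ^ 2 + b ^ 2) := h4
  have h6 : c ^ 2 ≤ a ^ 2 + b ^ 2 := le_of_mul_le_mul_left h5 hW2
  refine ⟨by linarith, fun h0 => ?_⟩
  -- equality: `c² = a² + b²`, so `(W² − A² − B²)(a² + b²) ≤ 0`, forcing `a = b = 0`, then `c = 0`
  have h7 : c ^ 2 = a ^ 2 + b ^ 2 := by linarith
  have h8 : (W ^ 2 - A ^ 2 - B ^ 2) * (a ^ 2 + b ^ 2) ≤ 0 := by nlinarith
  have h9 : a ^ 2 + b ^ 2 ≤ 0 := by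
    by_contra hpos
    have : 0 < (W ^ 2 - A ^ 2 - B ^ 2) * (a ^ 2 + b ^ 2) :=
      mul_pos (by linarith) (not_le.mp hpos)
    linarith
  have ha' : a = 0 := by nlinarith [sq_nonneg a, sq_nonneg b]
  have hb' : b = 0 := by nlinarith [sq_nonneg a, sq_nonneg b]
  have hc' : c = 0 := by nlinarith [sq_nonneg c]
  funext i
  fin_cases i
  · exact norm_eq_zero.mp ha'
  · exact norm_eq_zero.mp hb'
  · exact norm_eq_zero.mp hc'

/-- **Key positivity.**  For a negative vector `w` and `x ≠ 0`,
`hermJ21 x + (2/|hermJ21 w|) ‖⟨w, x⟩‖² > 0` (decompose `x = a w + y` with `⟨w, y⟩ = 0`). -/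
theorem hermJ21_add_pos {w : Fin 3 → ℂ} (hw : hermJ21 w < 0) {x : Fin 3 → ℂ} (hx : x ≠ 0) :
    0 < hermJ21 x + (2 / |hermJ21 w|) * ‖hermPair w x‖ ^ 2 := by
  set ν : ℝ := hermJ21 w with hν
  have hν0 : (ν : ℂ) ≠ 0 := by exact_mod_cast hw.ne
  set a : ℂ := hermPair w x / (ν : ℂ) with ha
  set y : Fin 3 → ℂ := x - a • w with hy
  have hxay : x = a • w + y := by rw [hy, add_sub_cancel]
  have hwy : hermPair w y = 0 := by
    rw [hy, hermPair_sub_right, hermPair_smul_right, hermPair_self, ha, div_mul_cancel₀ _ hν0,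
      sub_self]
  have hyw : hermPair y w = 0 := by rw [hermPair_conj, hwy, star_zero]
  -- `hermJ21 x = ‖a‖² ν + hermJ21 y`
  have key : (hermJ21 x : ℂ) = ((‖a‖ ^ 2 : ℝ) : ℂ) * (ν : ℂ) + (hermJ21 y : ℂ) := by
    rw [← hermPair_self, hxay]
    simp only [hermPair_add_left, hermPair_add_right, hermPair_smul_left, hermPair_smul_right,
      hwy, hyw, mul_zero, add_zero, zero_add]
    rw [hermPair_self, hermPair_self, ← hν]
    have hconj : (starRingEnd ℂ) a * a = ((‖a‖ ^ 2 : ℝ) : ℂ) := by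
      rw [Complex.conj_mul']; push_cast; ring
    simp only [Complex.star_def]
    rw [← hconj]
    ring
  have key' : hermJ21 x = ‖a‖ ^ 2 * ν + hermJ21 y := by exact_mod_cast key
  -- `‖⟨w, x⟩‖² = ‖a‖² ν²`
  have hs : ‖hermPair w x‖ ^ 2 = ‖a‖ ^ 2 * ν ^ 2 := by
    have : hermPair w x = a * (ν : ℂ) := by rw [ha, div_mul_cancel₀ _ hν0]
    rw [this, norm_mul, Complex.norm_real, Real.norm_eq_abs, mul_pow, sq_abs]
  have hy0 := hermJ21_nonneg_of_hermPair_eq_zero hw hwy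
  have hνabs : |ν| = -ν := abs_of_neg hw
  have htot : hermJ21 x + (2 / |ν|) * ‖hermPair w x‖ ^ 2 = ‖a‖ ^ 2 * (-ν) + hermJ21 y := by
    rw [key', hs, hνabs]
    field_simp
    ring
  rw [htot]
  by_contra hle
  rw [not_lt] at hle
  have hneg : 0 < -ν := by linarith
  have ha2 : 0 ≤ ‖a‖ ^ 2 * (-ν) := by positivity
  have hy1 : hermJ21 y = 0 := by linarith [hy0.1]
  have ha0 : ‖a‖ ^ 2 * (-ν) = 0 := by linarith [hy0.1]
  have ha' : a = 0 := by
    have : ‖a‖ ^ 2 = 0 := by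
      rcases mul_eq_zero.mp ha0 with h | h
      · exact h
      · exact absurd h hneg.ne'
    simpa using this
  apply hx
  rw [hxay, hy0.2 hy1, ha', zero_smul, add_zero]

/-! ### The invariant positive definite form of a negative line -/

/-- The Hermitian form `J + (2/|⟨w,w⟩|) (Jw)(Jw)ᴴ`; positive definite when `⟨w, w⟩ < 0`. -/
noncomputable def stabForm (w : Fin 3 → ℂ) : Matrix (Fin 3) (Fin 3) ℂ :=
  J21 + ((2 / |hermJ21 w| : ℝ) : ℂ) • vecMulVec (J21 *ᵥ w) (star (J21 *ᵥ w))

/-- `star (J w) ⬝ᵥ x = ⟨w, x⟩`. -/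
theorem star_J21_mulVec_dotProduct (w x : Fin 3 → ℂ) :
    star (J21 *ᵥ w) ⬝ᵥ x = hermPair w x := by
  unfold hermPair
  rw [star_mulVec, J21_conjTranspose, dotProduct_mulVec]

/-- The value of `stabForm w` on `x`. -/
theorem star_dotProduct_stabForm_mulVec (w x : Fin 3 → ℂ) :
    star x ⬝ᵥ (stabForm w *ᵥ x) =
      ((hermJ21 x + (2 / |hermJ21 w|) * ‖hermPair w x‖ ^ 2 : ℝ) : ℂ) := by
  unfold stabForm
  rw [add_mulVec, smul_mulVec, vecMulVec_mulVec, dotProduct_add, dotProduct_smul,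
    op_smul_eq_smul, dotProduct_smul, star_J21_mulVec_dotProduct,
    star_dotProduct_J21_mulVec, smul_eq_mul, smul_eq_mul]
  have : star x ⬝ᵥ (J21 *ᵥ w) = star (hermPair w x) := by
    rw [← hermPair_conj]; rfl
  rw [this, Complex.star_def, Complex.mul_conj, Complex.normSq_eq_norm_sq]
  push_cast
  ring

/-- `stabForm w` is Hermitian. -/
theorem stabForm_isHermitian (w : Fin 3 → ℂ) : (stabForm w).IsHermitian := by
  show (stabForm w)ᴴ = stabForm w
  unfold stabForm
  rw [conjTranspose_add, conjTranspose_smul, J21_conjTranspose, Complex.star_def,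
    Complex.conj_ofReal]
  congr 2
  ext i j
  simp only [conjTranspose_apply, vecMulVec_apply, Pi.star_apply, star_mul', star_star]
  ring

/-- **`stabForm w` is positive definite for a negative vector `w`.** -/
theorem stabForm_posDef {w : Fin 3 → ℂ} (hw : hermJ21 w < 0) : (stabForm w).PosDef :=
  PosDef.of_dotProduct_mulVec_pos (stabForm_isHermitian w) fun x hx => by
    rw [star_dotProduct_stabForm_mulVec]
    exact Complex.zero_lt_real.mpr (hermJ21_add_pos hw hx)

/-- An element of `U(2,1)` fixing a negative line acts on it by a scalar of absolute value `1`. -/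
theorem IsInU21.norm_eq_one_of_mulVec_eq_smul {α : Matrix (Fin 3) (Fin 3) ℂ} (hα : IsInU21 α)
    {w : Fin 3 → ℂ} (hw : hermJ21 w < 0) {c : ℂ} (h : α *ᵥ w = c • w) : ‖c‖ = 1 := by
  have h1 := hα.hermJ21_mulVec w
  rw [h, hermJ21_smul] at h1
  have h2 : ‖c‖ ^ 2 = 1 := by
    have := mul_right_cancel₀ hw.ne (h1.trans (one_mul _).symm)
    exact this
  have h3 : 0 ≤ ‖c‖ := norm_nonneg _
  nlinarith

/-- `αᴴ (J w) = c⁻¹ (J w)` when `α ∈ U(2,1)` and `α w = c w`. -/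
theorem IsInU21.conjTranspose_mulVec_J21_mulVec {α : Matrix (Fin 3) (Fin 3) ℂ} (hα : IsInU21 α)
    {w : Fin 3 → ℂ} {c : ℂ} (h : α *ᵥ w = c • w) (hc : c ≠ 0) :
    αᴴ *ᵥ (J21 *ᵥ w) = c⁻¹ • (J21 *ᵥ w) := by
  have e1 : (αᴴ * J21 * α) *ᵥ w = J21 *ᵥ w := by rw [hα]
  rw [← mulVec_mulVec, ← mulVec_mulVec, h, mulVec_smul, mulVec_smul] at e1
  rw [eq_inv_smul_iff₀ hc]
  exact e1

/-- **Invariance.**  Every `α ∈ U(2,1)` fixing the negative line `ℂ w` preserves `stabForm w`. -/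
theorem IsInU21.conjTranspose_mul_stabForm_mul {α : Matrix (Fin 3) (Fin 3) ℂ} (hα : IsInU21 α)
    {w : Fin 3 → ℂ} (hw : hermJ21 w < 0) {c : ℂ} (h : α *ᵥ w = c • w) :
    αᴴ * stabForm w * α = stabForm w := by
  have hc1 : ‖c‖ = 1 := hα.norm_eq_one_of_mulVec_eq_smul hw h
  have hc : c ≠ 0 := by
    rintro rfl
    simp at hc1
  have hJw := hα.conjTranspose_mulVec_J21_mulVec h hc
  unfold stabForm
  rw [Matrix.mul_add, Matrix.add_mul, Matrix.mul_smul, Matrix.smul_mul, hα, mul_vecMulVec,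
    vecMulVec_mul, hJw]
  congr 2
  have e : star (J21 *ᵥ w) ᵥ* α = star (αᴴ *ᵥ (J21 *ᵥ w)) := by
    rw [star_mulVec αᴴ (J21 *ᵥ w), conjTranspose_conjTranspose]
  rw [e, hJw, star_smul, smul_vecMulVec, vecMulVec_smul, smul_smul]
  have : c⁻¹ * star c⁻¹ = 1 := by
    rw [Complex.star_def, Complex.mul_conj, Complex.normSq_eq_norm_sq, norm_inv, hc1]
    simp
  rw [this, one_smul]

/-- **Bounded stabilisers.**  The stabiliser in `U(2,1)` of a negative line has bounded entries. -/
theorem exists_entry_bound_of_mulVec_eq_smul {w : Fin 3 → ℂ} (hw : hermJ21 w < 0) :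
    ∃ C : ℝ, ∀ α : Matrix (Fin 3) (Fin 3) ℂ, IsInU21 α → (∃ c : ℂ, α *ᵥ w = c • w) →
      ∀ i j, ‖α i j‖ ≤ C := by
  obtain ⟨C, hC⟩ := exists_entry_bound_of_posDef (stabForm_posDef hw)
  exact ⟨C, fun α hα ⟨c, hc⟩ i j => hC α (hα.conjTranspose_mul_stabForm_mul hw hc) i j⟩

/-! ### Fixed points on the ball -/

/-- If `α ∈ U(2,1)` fixes `z ∈ 𝔹²`, it fixes the line `ℂ · homog z`. -/
theorem IsInU21.exists_mulVec_homog_eq_smul_of_ballAction_eq {α : Matrix (Fin 3) (Fin 3) ℂ}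
    (hα : IsInU21 α) {z : Fin 2 → ℂ} (hz : z ∈ ball₂) (h : ballAction α z = z) :
    ∃ c : ℂ, α *ᵥ homog z = c • homog z := by
  have hne := hα.mulVec_homog_last_ne_zero hz
  set u : Fin 3 → ℂ := α *ᵥ homog z with hu
  refine ⟨u (Fin.last 2), ?_⟩
  have e : homog z = (u (Fin.last 2))⁻¹ • u := by
    rw [← homog_normalizeJ hne, ← ballAction_eq_normalizeJ, h]
  rw [e, smul_smul, mul_inv_cancel₀ hne, one_smul]


end Summit.Ventures.HodgeRepro2.ShimuraData
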